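import Literature.Probability.RandomPlanarGeometry.SAWTriangularLoopSurgery
import Literature.Probability.RandomPlanarGeometry.SAWTriangularDetourAdapter
import Literature.Probability.RandomPlanarGeometry.SAWTriangularDetourDensity
import Literature.Probability.RandomPlanarGeometry.SAWKestenInequalityAbstractNoGrowth
import Literature.Probability.RandomPlanarGeometry.SAWStretchedExponentialTail
import HarnessLib

/-!
# Kesten's one-step ratio inequality for self-avoiding LOOPS of the triangular lattice («TRI-SAP-RATIO», crux K82)

Topic `Literature/Probability/RandomPlanarGeometry` (lane «pcv-sawmu», route R82; continues
`SAWTriangularLoopSurgery.lean`). Sources: N. Madras, G. Slade, *The Self-Avoiding Walk* (1993), §7.3: Lemma 7.3.1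
hypothesis (iii), display (7.3.1) p. 242; Theorem 7.3.2 (proof, (7.3.5)–(7.3.11)) pp. 244–247, in particular (c)
`φ_N = c_{N+2}(0,x)/c_N(0,x)`; Theorem 7.4.5 (c) p. 254 (the fixed-endpoint ratio theorem, `x = e` being the polygon case
by (3.2.1)).

With the loop carrier of `SAWTriangularLoopSurgery.lean` (closure under interior detours, transfer counts (P1-L),
(P2-L)), the density (P3-L) transports the exponential, pattern-free density of detour-poor WALKS (`DetourDensityTri`,
K1′) to loops through a lower envelope `μ(𝕋)^M ≤ A e^{κ√M} · #loopSL M` — on `𝕋` this envelope is the «TRI-SAP» theorem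
`μ_polygon(𝕋) = μ(𝕋)` with its `e^{O(√N)}` window (lane R81, a-p3; here a HYPOTHESIS in exactly that shape), the stretched
exponential being absorbed by `SAWStretchedExponentialTail`; the assembly is the no-growth abstract Kesten step
`kesten_ineq_of_transfer_noGrowth` (a-p1), ONE-step (no parity split: a triangle detour adds one edge). Status in print:
Kesten's inequality for the fixed-endpoint classes is M–S Theorem 7.3.2 (c) on `ℤ^d` (two-step); nothing is printed for
`𝕋`; first written and kernel-checked here (planner a-idea-1's face `TriSAPKesten`, modulo the R81 envelope).

## Contents (namespace `Literature.Probability.RandomPlanarGeometry.SAW`; all PROVED, axioms standard)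

* `loopKesten_P3_of` (density over loops from `DetourDensityTri` + a loop envelope);
* **`loopKesten_of`**: `DetourDensityTri` + loop envelope ⇒ `∃ D, ∀ᶠ M, (ℓ_{M+1}/ℓ_M)² − D/M ≤ (ℓ_{M+1}/ℓ_M)(ℓ_{M+2}/ℓ_{M+1})`,
  `ℓ_M = #loopSL M`;
* `loopEnvelope_of_logEnvelope` (the R81-shaped log envelope on `t_N = ℓ_{N−1}` gives the loop envelope) and
  **`triLoopKesten_of_logEnvelope`**: the face `TriSAPKesten` of R82 in the brick-frame tokens
  `t N = #((brickSaws (N-1)).filter fun ω => brickGraph.Adj (ω (N-1)) 0)`, modulo the R81 log envelope.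
-/

noncomputable section

open Finset Filter Topology Literature.Probability.LatticeModels Literature.Probability.Percolation SimpleGraph
open scoped BigOperators

namespace Literature.Probability.RandomPlanarGeometry.SAW

/-! ### (P3-L) density over loops -/

/-- **(P3-L)**: the exponential density of detour-poor walks (`DetourDensityTri`) and a lower envelope
`μ(𝕋)^M ≤ A e^{κ√M} ℓ_M` for the loop counts give `#{ω ∈ loopSL M : J(ω) < M/(4Q)} ≤ C · ℓ_M / M³` for `M ≥ M₀`, `M ≥ 1`.
[cite: MadrasSlade1993, §7.3 (7.3.9)–(7.3.10) (proof of Theorem 7.3.2)] -/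
theorem loopKesten_P3_of (hD : DetourDensityTri) {κ A : ℝ} {M₀ : ℕ} (hκ : 0 ≤ κ) (hA : 0 < A)
    (hEnv : ∀ M : ℕ, M₀ ≤ M → Real.exp logMuTri ^ M ≤ A * Real.exp (κ * Real.sqrt M) * #(loopSL M)) :
    ∃ a > (0 : ℝ), ∃ C ≥ (0 : ℝ), ∀ M : ℕ, M₀ ≤ M → 1 ≤ M →
      (#((loopSL M).filter fun ω => ((#(triSharp ω) : ℕ) : ℝ) < a * M) : ℝ) ≤ C * #(loopSL M) / (M : ℝ) ^ 3 := by
  classical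
  obtain ⟨Q, hQ, C₀, hC₀⟩ := hD
  have hQr : (0 : ℝ) < Q := by exact_mod_cast hQ
  refine ⟨1 / (4 * Q), by positivity, max C₀ 0 * A * (16 * Real.exp ((κ + 3) ^ 2 * Q)), by positivity,
    fun M hM₀ hM => ?_⟩
  have hMr : (0 : ℝ) < M := by exact_mod_cast hM
  -- Step 1: the filter lies in the walk-density event `J ≤ M/(4Q)`
  have hsub : #((loopSL M).filter fun ω => ((#(triSharp ω) : ℕ) : ℝ) < 1 / (4 * (Q : ℝ)) * M) ≤
      {l : List (Site 2) | l ∈ sawLists triGraph (0 : Site 2) M ∧ detourCount l ≤ M / (4 * Q)}.ncard := by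
    rw [← Set.ncard_coe_finset]
    refine Set.ncard_le_ncard ?_ ((sawLists_finite triGraph (0 : Site 2) M).subset fun l hl => hl.1)
    intro ω hω
    rw [Finset.coe_filter, Set.mem_setOf_eq] at hω
    obtain ⟨hωL, hlt⟩ := hω
    refine ⟨mem_triSL.1 (loopSL_subset M hωL), ?_⟩
    rw [← card_triSharp_eq_detourCount, Nat.le_div_iff_mul_le (by positivity)]
    rw [div_mul_eq_mul_div, one_mul, lt_div_iff₀ (by positivity)] at hlt
    exact_mod_cast hlt.le
  -- Step 2: density, envelope, tail
  have hhalf : (0 : ℝ) ≤ (1 / 2 : ℝ) ^ (M / Q) := by positivity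
  have henv := hEnv M hM₀
  have htail := half_pow_div_mul_exp_mul_cube_le hQ hκ M
  have hL0 : (0 : ℝ) ≤ #(loopSL M) := Nat.cast_nonneg _
  have hM3 : (0 : ℝ) < (M : ℝ) ^ 3 := by positivity
  calc (#((loopSL M).filter fun ω => ((#(triSharp ω) : ℕ) : ℝ) < 1 / (4 * (Q : ℝ)) * M) : ℝ)
      ≤ (({l : List (Site 2) | l ∈ sawLists triGraph (0 : Site 2) M ∧ detourCount l ≤ M / (4 * Q)}.ncard : ℕ) : ℝ) := by
        exact_mod_cast hsub
    _ ≤ C₀ * (1 / 2 : ℝ) ^ (M / Q) * Real.exp logMuTri ^ M := hC₀ M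
    _ ≤ max C₀ 0 * (1 / 2 : ℝ) ^ (M / Q) * Real.exp logMuTri ^ M := by gcongr; exact le_max_left _ _
    _ ≤ max C₀ 0 * (1 / 2 : ℝ) ^ (M / Q) * (A * Real.exp (κ * Real.sqrt M) * #(loopSL M)) :=
        mul_le_mul_of_nonneg_left henv (by positivity)
    _ = max C₀ 0 * A * ((1 / 2 : ℝ) ^ (M / Q) * Real.exp (κ * Real.sqrt M) * (M : ℝ) ^ 3) *
          #(loopSL M) / (M : ℝ) ^ 3 := by
        field_simp
    _ ≤ max C₀ 0 * A * (16 * Real.exp ((κ + 3) ^ 2 * Q)) * #(loopSL M) / (M : ℝ) ^ 3 := by gcongr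

/-! ### Assembly: Kesten's one-step inequality for loops -/

/-- **Crux K82 over the loop carrier**: `DetourDensityTri` and a loop envelope give Kesten's one-step inequality
`(ℓ_{M+1}/ℓ_M)² − D/M ≤ (ℓ_{M+1}/ℓ_M)(ℓ_{M+2}/ℓ_{M+1})` eventually (`ℓ_M = #loopSL M`) — the abstract no-growth assembly
`kesten_ineq_of_transfer_noGrowth` with `S M := loopSL M`, `I = #triSlots`, `J = #triSharp`, `c₁ = 2`, `c₂ = 8`, `c₃ = 5`,
`c₄ = 2`. [cite: MadrasSlade1993, Theorem 7.3.2 (c) (proof, (7.3.5)–(7.3.11)); Lemma 7.3.1 (iii) (7.3.1)] -/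
theorem loopKesten_of (hD : DetourDensityTri) {κ A : ℝ} {M₀ : ℕ} (hκ : 0 ≤ κ) (hA : 0 < A)
    (hEnv : ∀ M : ℕ, M₀ ≤ M → Real.exp logMuTri ^ M ≤ A * Real.exp (κ * Real.sqrt M) * #(loopSL M)) :
    ∃ D : ℝ, ∀ᶠ M : ℕ in atTop,
      ((#(loopSL (M + 1)) : ℝ) / #(loopSL M)) ^ 2 - D / M ≤
        ((#(loopSL (M + 1)) : ℝ) / #(loopSL M)) * ((#(loopSL (M + 2)) : ℝ) / #(loopSL (M + 1))) := by
  obtain ⟨a, ha, C, hC0, hC⟩ := loopKesten_P3_of hD hκ hA hEnv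
  have hpos : ∀ M, M₀ ≤ M → 0 < #(loopSL M) := by
    intro M hM
    have h := hEnv M hM
    by_contra h0
    push Not at h0
    have : #(loopSL M) = 0 := by omega
    rw [this] at h
    simp only [Nat.cast_zero, mul_zero] at h
    exact absurd h (not_le.2 (pow_pos (Real.exp_pos _) M))
  exact kesten_ineq_of_transfer_noGrowth (α := List (Site 2)) loopSL (fun _ ω => #(triSlots ω))
    (fun _ ω => #(triSharp ω)) M₀ (a := a) (C := C) (c₁ := 2) (c₂ := 8) (c₃ := 5) (c₄ := 2)
    ha hC0 (by norm_num) (by norm_num) (by norm_num) (by norm_num)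
    (fun M hM => hpos M hM)
    (fun M _ ω hω => by
      have h := card_triSlots_le (loopSL_subset M hω)
      calc ((#(triSlots ω) : ℕ) : ℝ) ≤ ((2 * M : ℕ) : ℝ) := by exact_mod_cast h
        _ = 2 * (M : ℝ) := by push_cast; ring)
    (fun M _ => loopKesten_P1' M)
    (fun M _ => by
      refine le_trans (sum_le_sum fun ω _ => ?_) (loopKesten_P2 M)
      set I : ℝ := (#(triSlots ω) : ℝ)
      set J : ℝ := (#(triSharp ω) : ℝ)
      have hI0 : 0 ≤ I := Nat.cast_nonneg _
      have hJ0 : 0 ≤ J := Nat.cast_nonneg _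
      have hden : 0 < (J + 3) * (J + 6) := by positivity
      have hden' : 0 < (J + 5) * (J + 5 + 1) := by positivity
      by_cases h8 : 8 ≤ I
      · have hmax : max 0 (I - 8) = I - 8 := max_eq_right (by linarith)
        rw [hmax]
        apply div_le_div_of_nonneg_left (by nlinarith) hden
        nlinarith
      · have hneg : I * (I - 8) / ((J + 5) * (J + 5 + 1)) ≤ 0 :=
          div_nonpos_of_nonpos_of_nonneg (by nlinarith) hden'.le
        have hpos' : 0 ≤ I * max 0 (I - 8) / ((J + 3) * (J + 6)) := by positivity
        linarith)
    (fun M hM hM1 => hC M hM hM1)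

/-! ### From the R81 log envelope to the loop envelope, and the face in brick-frame tokens -/

/-- The R81-shaped log envelope `|log t_N − N·logMuTri| ≤ c√N` (`N ≥ 4`) on `t_N := ℓ_{N−1}` gives the loop envelope
`μ^M ≤ (e^c/μ) e^{c√M} ℓ_M` for `M ≥ 3`. [cite: MadrasSlade1993, Theorem 3.2.3 / Corollary 3.2.5 (polygon growth window)] -/
theorem loopEnvelope_of_logEnvelope {c : ℝ} (hc : 0 ≤ c)
    (hEnv : ∀ N : ℕ, 4 ≤ N → (0 : ℝ) < #(loopSL (N - 1)) ∧
      |Real.log (#(loopSL (N - 1)) : ℝ) - N * logMuTri| ≤ c * Real.sqrt N) :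
    ∀ M : ℕ, 3 ≤ M → Real.exp logMuTri ^ M ≤
      (Real.exp c / Real.exp logMuTri) * Real.exp (c * Real.sqrt M) * #(loopSL M) := by
  intro M hM
  obtain ⟨hpos, habs⟩ := hEnv (M + 1) (by omega)
  rw [show M + 1 - 1 = M by omega] at hpos habs
  set t : ℝ := (#(loopSL M) : ℝ) with ht
  have hμ := Real.exp_pos logMuTri
  -- `(M+1) L − c √(M+1) ≤ log t`
  have h1 : ((M + 1 : ℕ) : ℝ) * logMuTri - c * Real.sqrt ((M + 1 : ℕ) : ℝ) ≤ Real.log t := by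
    have := (abs_le.1 habs).1
    linarith
  -- `√(M+1) ≤ √M + 1`
  have hsq : Real.sqrt ((M : ℝ) + 1) ≤ Real.sqrt M + 1 := by
    rw [Real.sqrt_le_left (by positivity)]
    nlinarith [Real.sq_sqrt (Nat.cast_nonneg M), Real.sqrt_nonneg (M : ℝ)]
  have h2 : ((M : ℝ) + 1) * logMuTri - c * (Real.sqrt M + 1) ≤ Real.log t := by
    have : c * Real.sqrt ((M : ℝ) + 1) ≤ c * (Real.sqrt M + 1) := mul_le_mul_of_nonneg_left hsq hc
    push_cast at h1
    linarith
  have h3 : Real.exp (((M : ℝ) + 1) * logMuTri - c * (Real.sqrt M + 1)) ≤ t := by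
    rw [← Real.exp_log hpos]
    exact Real.exp_le_exp.2 h2
  -- rearrange
  have e : Real.exp logMuTri ^ M =
      (Real.exp c / Real.exp logMuTri) * Real.exp (c * Real.sqrt M) *
        Real.exp (((M : ℝ) + 1) * logMuTri - c * (Real.sqrt M + 1)) := by
    rw [← Real.exp_nat_mul, div_eq_mul_inv, ← Real.exp_neg, ← Real.exp_add, ← Real.exp_add, ← Real.exp_add]
    ring_nf
  rw [e]
  exact mul_le_mul_of_nonneg_left h3 (by positivity)

/-- **K82 «TRI-SAP-KESTEN» modulo the R81 envelope, in the brick-frame tokens of the face `TriSAPKesten`**: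
with `t N := #{ω ∈ brickSaws (N−1) : ω (N−1) ~ 0}` (rooted oriented self-avoiding polygons of length `N` on `𝕋`),
the R81-shaped log envelope `|log t_N − N·logMuTri| ≤ (53 + 3·logMuTri)√N` (`N ≥ 4`, with `t_N > 0`) implies Kesten's
one-step inequality `(t_{N+1}/t_N)² − D/N ≤ (t_{N+1}/t_N)(t_{N+2}/t_{N+1})` eventually.
[cite: MadrasSlade1993, Theorem 7.3.2 (c) (7.3.4), p. 244; Theorem 7.4.5 (c), p. 254] -/
theorem triLoopKesten_of_logEnvelope
    (hEnv : ∀ N : ℕ, 4 ≤ N →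
      (0 : ℝ) < #((brickSaws (N - 1)).filter fun ω => brickGraph.Adj (ω (N - 1)) 0) ∧
      |Real.log (#((brickSaws (N - 1)).filter fun ω => brickGraph.Adj (ω (N - 1)) 0) : ℝ) - N * logMuTri| ≤
        (53 + 3 * logMuTri) * Real.sqrt N) :
    ∃ D : ℝ, ∀ᶠ N : ℕ in atTop,
      ((#((brickSaws (N + 1 - 1)).filter fun ω => brickGraph.Adj (ω (N + 1 - 1)) 0) : ℝ) /
          #((brickSaws (N - 1)).filter fun ω => brickGraph.Adj (ω (N - 1)) 0)) ^ 2 - D / N ≤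
        ((#((brickSaws (N + 1 - 1)).filter fun ω => brickGraph.Adj (ω (N + 1 - 1)) 0) : ℝ) /
          #((brickSaws (N - 1)).filter fun ω => brickGraph.Adj (ω (N - 1)) 0)) *
        ((#((brickSaws (N + 2 - 1)).filter fun ω => brickGraph.Adj (ω (N + 2 - 1)) 0) : ℝ) /
          #((brickSaws (N + 1 - 1)).filter fun ω => brickGraph.Adj (ω (N + 1 - 1)) 0)) := by
  classical
  have hc : (0 : ℝ) ≤ 53 + 3 * logMuTri := by
    have h5 : (0 : ℝ) ≤ Real.log (1 + Real.sqrt 5) :=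
      Real.log_nonneg (by have := Real.sqrt_nonneg 5; linarith)
    have hL : 0 ≤ logMuTri := h5.trans log_one_add_sqrt_five_le_logMuTri
    linarith
  -- translate the hypothesis to the list model
  have hEnv' : ∀ N : ℕ, 4 ≤ N → (0 : ℝ) < #(loopSL (N - 1)) ∧
      |Real.log (#(loopSL (N - 1)) : ℝ) - N * logMuTri| ≤ (53 + 3 * logMuTri) * Real.sqrt N := by
    intro N hN
    have h := hEnv N hN
    rwa [← card_loopSL] at h
  have hLE := loopEnvelope_of_logEnvelope hc hEnv'
  have hA : 0 < Real.exp (53 + 3 * logMuTri) / Real.exp logMuTri := by positivity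
  obtain ⟨D, hD⟩ := loopKesten_of detourDensityTri (M₀ := 3) hc hA hLE
  -- reindex `M = N − 1`, `D/M ≤ 2D⁺/N`
  refine ⟨2 * max D 0, ?_⟩
  obtain ⟨M₁, hM₁⟩ := Filter.eventually_atTop.1 hD
  refine Filter.eventually_atTop.2 ⟨M₁ + 2, fun N hN => ?_⟩
  obtain ⟨M, rfl⟩ : ∃ M, N = M + 1 := ⟨N - 1, by omega⟩
  have hM : M₁ ≤ M := by omega
  have h := hM₁ M hM
  simp only [show M + 1 - 1 = M by omega, show M + 1 + 1 - 1 = M + 1 by omega,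
    show M + 1 + 2 - 1 = M + 2 by omega, ← card_loopSL]
  have hM1 : (1 : ℝ) ≤ M := by exact_mod_cast (show 1 ≤ M by omega)
  have hM0 : (0 : ℝ) < M := by linarith
  have hfrac : D / (M : ℝ) ≤ 2 * max D 0 / ((M + 1 : ℕ) : ℝ) := by
    push_cast
    rw [div_le_div_iff₀ hM0 (by positivity)]
    have hD0 : D ≤ max D 0 := le_max_left _ _
    have hmax : 0 ≤ max D 0 := le_max_right _ _
    nlinarith
  linarith

end Literature.Probability.RandomPlanarGeometry.SAW
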